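import Mathlib
import HarnessLib
import Literature.MathematicalPhysics.QuantumLattice.KohnLuttingerChannelStates
import Summits.HubbardSuperconductivity.HubbardSuperconductivity.Theorems.WeakCouplingBCSKlThirdOrderSelectionWindow

/-!
# Route `WeakCouplingBCS` — channel-margin lane of `WcbcsKohnLuttingerB1g` (stmt-HubbardSuperconductivity-0158):
# third-order `B1g` selection against the CHANNEL BOTTOMS `channelInf3` (the competitor-state side condition discharged)

`klThirdOrder_selection_of_lower` (`Theorems/WeakCouplingBCSKlThirdOrderSelection.lean`) concludes
`thirdOrderForm ε₀ μ U ψ_B < channelInf3 ε₀ μ U χ` under the side condition that the competitor channel `χ` has a normalised channel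
state on `F_μ`.  That side condition is a theorem of the tree: `Literature…exists_isChannelState` (every `D₄` channel has a channel
state on the square-lattice Fermi curve, `-4 < μ < 0`).  This file removes it:

* `klThirdOrder_lt_channelInf3` — generic (record box with usable Ritz data + enclosures, certified competitor lower bounds, a consistent row,
  its named third-order hypotheses): for `0 < U ≤ r.U0` and every `χ ≠ B1g`, `thirdOrderForm ε₀ μ U ψ_B < channelInf3 ε₀ μ U χ`; and
  `channelInf3 ε₀ μ U B1g < channelInf3 ε₀ μ U χ` as soon as the form is bounded below on the `B1g` channel states (the one remaining side
  condition — true for a bounded kernel, not proved here);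
* `klThirdOrder_lt_channelInf3_d010_certfloor` — record `klCertB1gD010`, certified floor row, `U ≤ 1215/2²⁰`;
* `klThirdOrder_lt_channelInf3_window` — every `μ ∈ [-0.42749, -0.1775]`, `U ≤ klU0WindowU`, rows `klU0WindowRows` × records `klCertB1gWin{A,B,C}`;
* `klto_bddBelow_b1g`, `klThirdOrder_channelInf3_lt`, **`klThirdOrder_channelInf3_lt_window`** — the `B1g` side condition discharged by ONE more named
  hypothesis, a lower bound of the `K₃`-form on the `B1g` states (for the window rows: the `A2g` datum read on `B1g`, certified by the same
  channel-independent Hilbert–Schmidt numbers): `channelInf3 ε₀ μ U B1g < channelInf3 ε₀ μ U χ` for every `μ` of the window, `0 < U ≤ klU0WindowU`, `χ ≠ B1g`.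

Honest framing as in the companion files: conditional on the named numerical hypotheses (`EnclosuresB1g`, `ThirdOrderEnclosures` /
`KlThirdOrderWindowEnclosures`), certified by the cell's interval arithmetic; orders `≥ 4` not addressed; nothing asserts a pairing instability.
-/

noncomputable section

-- the tree's namespace `Summit.<Summit>.<Problem>.Theorems` repeats the summit name by design (D-0017)
set_option linter.dupNamespace false

namespace Summit.HubbardSuperconductivity.HubbardSuperconductivity.Theorems

open MeasureTheory Literature.MathematicalPhysics.QuantumLattice CwKLChiralWindow KlThirdOrder

/-- **Third-order `B1g` selection against the channel bottoms** (generic): under the hypotheses of `klThirdOrder_selection_of_lower`, for every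
`0 < U ≤ r.U0` and every `χ ≠ B1g`, the normalised `B1g` Ritz trial lies strictly below the third-order channel bottom of `χ`,
`thirdOrderForm ε₀ μ U ψ_B < channelInf3 ε₀ μ U χ` (competitor states exist: `exists_isChannelState`); and
`channelInf3 ε₀ μ U B1g < channelInf3 ε₀ μ U χ` whenever the form is bounded below on the `B1g` states. [cite: RaghuKivelsonScalapino2010, App. A] -/
theorem klThirdOrder_lt_channelInf3 {μ : ℝ} (hμ : μ ∈ Set.Ioo (-4 : ℝ) 0) (bx : KLBox) (tab : List KLTrig)
    (hritz : bx.bB1g.ritzOK tab D4Irrep.B1g = true) (hER : bx.bB1g.RitzEnclosure tab μ)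
    (hlower : ∀ χ : D4Irrep, χ ≠ D4Irrep.B1g →
      (((bx.blk χ).lower tab χ : ℚ) : ℝ) ≤ channelInf (squareDispersion 1 0) μ 1 χ)
    (r : KLU0Row) (hr : r.ok = true) (hdom : r.dominates bx tab = true)
    (h3 : r.ThirdOrderEnclosures μ (bx.bB1g.trialFun tab)) :
    ∃ ψ : Momentum → ℝ, IsChannelState (squareDispersion 1 0) μ D4Irrep.B1g ψ ∧
      ∀ U : ℝ, 0 < U → U ≤ r.U0 → ∀ χ : D4Irrep, χ ≠ D4Irrep.B1g →
        thirdOrderForm (squareDispersion 1 0) μ U ψ < channelInf3 (squareDispersion 1 0) μ U χ ∧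
        (BddBelow (thirdOrderForm (squareDispersion 1 0) μ U ''
            {ψ' | IsChannelState (squareDispersion 1 0) μ D4Irrep.B1g ψ'}) →
          channelInf3 (squareDispersion 1 0) μ U D4Irrep.B1g < channelInf3 (squareDispersion 1 0) μ U χ) := by
  obtain ⟨ψ, hψ, h⟩ := klThirdOrder_selection_of_lower hμ bx tab hritz hER hlower r hr hdom h3
  exact ⟨ψ, hψ, fun U hU hUU χ hχ => (h U hU hUU χ hχ).2 (exists_isChannelState hμ.1 hμ.2 χ)⟩

/-- **At `δ ≈ 0.10`** (record `klCertB1gD010`, certified floor row `klU0_d010_certfloor_nc16384_2loop_C4_0`): modulo `klCertB1gD010.EnclosuresB1g` and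
the row's `ThirdOrderEnclosures μ₀ Φ_B`, for every `0 < U ≤ 1215/2²⁰` and every `χ ≠ B1g` the normalised `B1g` Ritz trial lies strictly below
`channelInf3 ε₀ μ₀ U χ`. [cite: RaghuKivelsonScalapino2010, App. A] -/
theorem klThirdOrder_lt_channelInf3_d010_certfloor (hE : klCertB1gD010.EnclosuresB1g) :
    ∀ bx ∈ klCertB1gD010.boxes,
      klU0_d010_certfloor_nc16384_2loop_C4_0.ThirdOrderEnclosures ((bx.mulo : ℚ) : ℝ)
          (bx.bB1g.trialFun klCertB1gD010.trials) →
        ∃ ψ : Momentum → ℝ, IsChannelState (squareDispersion 1 0) ((bx.mulo : ℚ) : ℝ) D4Irrep.B1g ψ ∧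
          ∀ U : ℝ, 0 < U → U ≤ 1215 / 1048576 → ∀ χ : D4Irrep, χ ≠ D4Irrep.B1g →
            thirdOrderForm (squareDispersion 1 0) ((bx.mulo : ℚ) : ℝ) U ψ <
              channelInf3 (squareDispersion 1 0) ((bx.mulo : ℚ) : ℝ) U χ := by
  intro bx hbx h3
  have hall := List.all_eq_true.1 klCertB1gD010_boxes_all bx hbx
  simp only [Bool.and_eq_true] at hall
  have hB := hall.1
  have hB' := hB
  simp only [KLBox.basicOKB1g, Bool.and_eq_true, decide_eq_true_eq] at hB'
  obtain ⟨⟨⟨⟨⟨⟨⟨h4, hle⟩, h0⟩, -⟩, -⟩, -⟩, -⟩, -⟩ := hB'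
  have hμI : ((bx.mulo : ℚ) : ℝ) ∈ Set.Icc ((bx.mulo : ℚ) : ℝ) ((bx.muhi : ℚ) : ℝ) :=
    ⟨le_rfl, by exact_mod_cast hle⟩
  have hμ : ((bx.mulo : ℚ) : ℝ) ∈ Set.Ioo (-4 : ℝ) 0 :=
    ⟨by exact_mod_cast h4, lt_of_le_of_lt (by exact_mod_cast hle : ((bx.mulo : ℚ) : ℝ) ≤ bx.muhi) (by exact_mod_cast h0)⟩
  obtain ⟨hER, hEχ⟩ := hE bx hbx _ hμI
  obtain ⟨hritz, hlower⟩ := klto_lower_of_basicOKB1g hμ bx klCertB1gD010.trials hB hEχ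
  obtain ⟨ψ, hψ, h⟩ := klThirdOrder_lt_channelInf3 hμ bx klCertB1gD010.trials hritz hER hlower _
    klU0_d010_certfloor_nc16384_2loop_C4_0_ok (List.all_eq_true.1 klto_d010_certfloor_dominates bx hbx) h3
  refine ⟨ψ, hψ, fun U hU hUU χ hχ => (h U hU ?_ χ hχ).1⟩
  have hU0 : klU0_d010_certfloor_nc16384_2loop_C4_0.U0 = (1215 : ℚ) / 1048576 := rfl
  rw [hU0]
  push_cast
  exact hUU

/-- **On the whole window** `μ ∈ [-0.42749, -0.1775]`: modulo `klCertB1gWin{A,B,C}.EnclosuresB1g` and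
`KlThirdOrderWindowEnclosures klU0WindowRows [klCertB1gWinA, klCertB1gWinB, klCertB1gWinC]`, for every `0 < U ≤ klU0WindowU` and every
`χ ≠ B1g` some normalised `B1g` state on `F_μ` lies strictly below `channelInf3 ε₀ μ U χ`. [cite: RaghuKivelsonScalapino2010, App. A] -/
theorem klThirdOrder_lt_channelInf3_window (hA : klCertB1gWinA.EnclosuresB1g) (hB : klCertB1gWinB.EnclosuresB1g)
    (hC : klCertB1gWinC.EnclosuresB1g)
    (h3 : KlThirdOrderWindowEnclosures klU0WindowRows [klCertB1gWinA, klCertB1gWinB, klCertB1gWinC]) :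
    ∀ μ : ℝ, ((((-42749 : ℚ) / 100000) : ℚ) : ℝ) ≤ μ → μ ≤ ((((-71 : ℚ) / 400) : ℚ) : ℝ) →
      ∃ ψ : Momentum → ℝ, IsChannelState (squareDispersion 1 0) μ D4Irrep.B1g ψ ∧
        ∀ U : ℝ, 0 < U → U ≤ ((klU0WindowU : ℚ) : ℝ) → ∀ χ : D4Irrep, χ ≠ D4Irrep.B1g →
          thirdOrderForm (squareDispersion 1 0) μ U ψ < channelInf3 (squareDispersion 1 0) μ U χ := by
  intro μ hμ₁ hμ₂
  obtain ⟨-, hcov⟩ := klU0Win_cover _ _ _ _ klU0WindowRows_check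
  obtain ⟨w, hw, hlo, hhi, hok, hu⟩ := hcov μ hμ₁ hμ₂
  obtain ⟨c, hc, bx, hbx, hcl, hch, hdom⟩ := klThirdOrderWindowJoin_spec _ _ klto_window_join w hw
  obtain ⟨hcheckc, hEc⟩ := klto_window_recs hA hB hC c hc
  obtain ⟨-, hboxes, -⟩ := klb1gd_coverLogic c hcheckc
  obtain ⟨hBx, -⟩ := hboxes bx hbx
  have hB' := hBx
  simp only [KLBox.basicOKB1gD, Bool.and_eq_true, decide_eq_true_eq] at hB'
  obtain ⟨⟨⟨⟨⟨⟨⟨h4, -⟩, h0⟩, -⟩, -⟩, -⟩, -⟩, -⟩ := hB'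
  have hlo' : ((bx.mulo : ℚ) : ℝ) ≤ μ := le_trans (by exact_mod_cast hcl) hlo
  have hhi' : μ ≤ ((bx.muhi : ℚ) : ℝ) := le_trans hhi (by exact_mod_cast hch)
  have hμ : μ ∈ Set.Ioo (-4 : ℝ) 0 :=
    ⟨lt_of_lt_of_le (by exact_mod_cast h4) hlo', lt_of_le_of_lt hhi' (by exact_mod_cast h0)⟩
  obtain ⟨hER, hEχ⟩ := hEc bx hbx μ ⟨hlo', hhi'⟩
  have h3w := h3 w hw c hc bx hbx hcl hch hdom μ hlo hhi
  obtain ⟨hritz, hlower⟩ := klto_lower_of_basicOKB1gD hμ bx c.trials hBx hEχ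
  obtain ⟨ψ, hψ, hsel⟩ := klThirdOrder_lt_channelInf3 hμ bx c.trials hritz hER hlower w.row hok hdom h3w
  exact ⟨ψ, hψ, fun U hU hUu χ hχ => (hsel U hU (le_trans hUu (by exact_mod_cast hu)) χ hχ).1⟩

/-! ### The `B1g` side condition: boundedness below from a `B1g` lower bound of the `K₃`-form -/

/-- If the `K₃`-form is bounded below by `-m` on the normalised `B1g` states, then the truncated vertex form is bounded below on them
(`(∫ψ)²/U ≥ 0`, `⟨ψ, χ₀ ψ⟩ ≥ -‖χ₀‖_{HS}` by the Hilbert–Schmidt frame `stub_klFrameHS`, `U⟨ψ,K₃ψ⟩ ≥ -U m`), so `channelInf3 ε₀ μ U B1g` is a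
genuine infimum. [folklore] -/
theorem klto_bddBelow_b1g {μ : ℝ} (hμ : μ ∈ Set.Ioo (-4 : ℝ) 0) {U : ℝ} (hU : 0 < U) (m : ℝ)
    (hm : ∀ ψ : Momentum → ℝ, IsChannelState (squareDispersion 1 0) μ D4Irrep.B1g ψ →
      -m ≤ kform (fermiCurveMeasure (squareDispersion 1 0) μ) (klThirdOrderKernel (squareDispersion 1 0) μ) ψ) :
    BddBelow (thirdOrderForm (squareDispersion 1 0) μ U '' {ψ | IsChannelState (squareDispersion 1 0) μ D4Irrep.B1g ψ}) := by
  set H : ℝ := Real.sqrt (∫ z, (lindhardFunction (squareDispersion 1 0) μ (z.1 + z.2)) ^ 2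
      ∂(fermiCurveMeasure (squareDispersion 1 0) μ).prod (fermiCurveMeasure (squareDispersion 1 0) μ)) with hH
  refine ⟨-H - U * m, ?_⟩
  rintro x ⟨ψ, hψ, rfl⟩
  obtain ⟨-, hbd⟩ := stub_klFrameHS stub_klKernelHS μ hμ 1 ψ hψ.1
  rw [hψ.2.1, one_mul] at hbd
  have h2 : -H ≤ kform (fermiCurveMeasure (squareDispersion 1 0) μ) (lindhardKernel (squareDispersion 1 0) μ) ψ := by
    have := neg_abs_le (∫ k, ψ k * ∫ k', lindhardFunction (squareDispersion 1 0) μ (k + k') * ψ k'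
      ∂fermiCurveMeasure (squareDispersion 1 0) μ ∂fermiCurveMeasure (squareDispersion 1 0) μ)
    unfold kform lindhardKernel
    linarith
  have h3 := mul_le_mul_of_nonneg_left (hm ψ hψ) hU.le
  have h1 : 0 ≤ (∫ k, ψ k ∂fermiCurveMeasure (squareDispersion 1 0) μ) ^ 2 / U := div_nonneg (sq_nonneg _) hU.le
  unfold thirdOrderForm
  linarith

/-- **`channelInf3 B1g < channelInf3 χ`** (generic): under the hypotheses of `klThirdOrder_lt_channelInf3` and a lower bound of the `K₃`-form on
the `B1g` states (e.g. a channel datum `c` with `c.ThirdOrderLowerBound μ B1g` — for the WINDOW rows the even-channel data `s3 = ‖2x̄²‖_HS`,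
`t = ‖N̄_V+N̄_P‖_HS` are channel-independent Hilbert–Schmidt bounds, valid on every even state, hence on `B1g`), for every `0 < U ≤ r.U0` and
every `χ ≠ B1g`: `channelInf3 ε₀ μ U B1g < channelInf3 ε₀ μ U χ`. [cite: RaghuKivelsonScalapino2010, App. A] -/
theorem klThirdOrder_channelInf3_lt {μ : ℝ} (hμ : μ ∈ Set.Ioo (-4 : ℝ) 0) (bx : KLBox) (tab : List KLTrig)
    (hritz : bx.bB1g.ritzOK tab D4Irrep.B1g = true) (hER : bx.bB1g.RitzEnclosure tab μ)
    (hlower : ∀ χ : D4Irrep, χ ≠ D4Irrep.B1g →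
      (((bx.blk χ).lower tab χ : ℚ) : ℝ) ≤ channelInf (squareDispersion 1 0) μ 1 χ)
    (r : KLU0Row) (hr : r.ok = true) (hdom : r.dominates bx tab = true)
    (h3 : r.ThirdOrderEnclosures μ (bx.bB1g.trialFun tab))
    (cB : KLU0Chan) (hB1g : cB.ThirdOrderLowerBound μ D4Irrep.B1g) :
    ∀ U : ℝ, 0 < U → U ≤ r.U0 → ∀ χ : D4Irrep, χ ≠ D4Irrep.B1g →
      channelInf3 (squareDispersion 1 0) μ U D4Irrep.B1g < channelInf3 (squareDispersion 1 0) μ U χ := by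
  obtain ⟨ψ, -, h⟩ := klThirdOrder_lt_channelInf3 hμ bx tab hritz hER hlower r hr hdom h3
  intro U hU hUU χ hχ
  exact (h U hU hUU χ hχ).2 (klto_bddBelow_b1g hμ hU _ hB1g)

/-- **On the whole window, `B1g` has the strictly lowest third-order channel bottom**: for every `μ ∈ [-0.42749, -0.1775]`, every
`0 < U ≤ klU0WindowU = 1145/2²⁴` and every `χ ∈ {A1g, A2g, B2g, E}`, `channelInf3 ε₀ μ U B1g < channelInf3 ε₀ μ U χ` — modulo the NAMED
hypotheses `klCertB1gWin{A,B,C}.EnclosuresB1g`, `KlThirdOrderWindowEnclosures klU0WindowRows [WinA, WinB, WinC]`, and, for each window row,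
its `A2g` datum read on the `B1g` states (`(w.row.chanOf A2g).ThirdOrderLowerBound μ B1g` for every `μ` of the row's box: certified by the same
channel-independent Hilbert–Schmidt numbers `h3`, `t_even` of U0-TABLE v3 §2/§4).  Existence-grade threshold; nothing here asserts a pairing
instability. [cite: RaghuKivelsonScalapino2010, App. A] -/
theorem klThirdOrder_channelInf3_lt_window (hA : klCertB1gWinA.EnclosuresB1g) (hB : klCertB1gWinB.EnclosuresB1g)
    (hC : klCertB1gWinC.EnclosuresB1g)
    (h3 : KlThirdOrderWindowEnclosures klU0WindowRows [klCertB1gWinA, klCertB1gWinB, klCertB1gWinC])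
    (hB1g : ∀ w ∈ klU0WindowRows, ∀ μ : ℝ, ((w.mulo : ℚ) : ℝ) ≤ μ → μ ≤ ((w.muhi : ℚ) : ℝ) →
      (w.row.chanOf D4Irrep.A2g).ThirdOrderLowerBound μ D4Irrep.B1g) :
    ∀ μ : ℝ, ((((-42749 : ℚ) / 100000) : ℚ) : ℝ) ≤ μ → μ ≤ ((((-71 : ℚ) / 400) : ℚ) : ℝ) →
      ∀ U : ℝ, 0 < U → U ≤ ((klU0WindowU : ℚ) : ℝ) → ∀ χ : D4Irrep, χ ≠ D4Irrep.B1g →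
        channelInf3 (squareDispersion 1 0) μ U D4Irrep.B1g < channelInf3 (squareDispersion 1 0) μ U χ := by
  intro μ hμ₁ hμ₂
  obtain ⟨-, hcov⟩ := klU0Win_cover _ _ _ _ klU0WindowRows_check
  obtain ⟨w, hw, hlo, hhi, hok, hu⟩ := hcov μ hμ₁ hμ₂
  obtain ⟨c, hc, bx, hbx, hcl, hch, hdom⟩ := klThirdOrderWindowJoin_spec _ _ klto_window_join w hw
  obtain ⟨hcheckc, hEc⟩ := klto_window_recs hA hB hC c hc
  obtain ⟨-, hboxes, -⟩ := klb1gd_coverLogic c hcheckc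
  obtain ⟨hBx, -⟩ := hboxes bx hbx
  have hB' := hBx
  simp only [KLBox.basicOKB1gD, Bool.and_eq_true, decide_eq_true_eq] at hB'
  obtain ⟨⟨⟨⟨⟨⟨⟨h4, -⟩, h0⟩, -⟩, -⟩, -⟩, -⟩, -⟩ := hB'
  have hlo' : ((bx.mulo : ℚ) : ℝ) ≤ μ := le_trans (by exact_mod_cast hcl) hlo
  have hhi' : μ ≤ ((bx.muhi : ℚ) : ℝ) := le_trans hhi (by exact_mod_cast hch)
  have hμ : μ ∈ Set.Ioo (-4 : ℝ) 0 :=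
    ⟨lt_of_lt_of_le (by exact_mod_cast h4) hlo', lt_of_le_of_lt hhi' (by exact_mod_cast h0)⟩
  obtain ⟨hER, hEχ⟩ := hEc bx hbx μ ⟨hlo', hhi'⟩
  have h3w := h3 w hw c hc bx hbx hcl hch hdom μ hlo hhi
  obtain ⟨hritz, hlower⟩ := klto_lower_of_basicOKB1gD hμ bx c.trials hBx hEχ
  intro U hU hUu χ hχ
  exact klThirdOrder_channelInf3_lt hμ bx c.trials hritz hER hlower w.row hok hdom h3w _ (hB1g w hw μ hlo hhi)
    U hU (le_trans hUu (by exact_mod_cast hu)) χ hχ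

/-- **At `δ ≈ 0.10`, `B1g` has the strictly lowest third-order channel bottom**: for the box of `klCertB1gD010` (`μ₀ = -0.17983` in binary64),
every `0 < U ≤ 1215/2²⁰` and every `χ ≠ B1g`, `channelInf3 ε₀ μ₀ U B1g < channelInf3 ε₀ μ₀ U χ` — modulo `klCertB1gD010.EnclosuresB1g`, the certified
floor row's `ThirdOrderEnclosures μ₀ Φ_B`, and ONE `B1g`-valid lower bound of the `K₃`-form at `μ₀`, taken as the `A2g` datum of the window row `klU0w43`
read on the `B1g` states (its box `[-0.1825, -0.1775]` contains `μ₀`; its `s3 = ‖2x̄²‖_HS = 7.198`, `t = ‖N̄_V+N̄_P‖_HS = 188.732` are channel-independent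
Hilbert–Schmidt numbers certified uniformly on that box, U0-TABLE v3 §2/§4, hence valid on every even state at `μ₀`). [cite: RaghuKivelsonScalapino2010, App. A] -/
theorem klThirdOrder_channelInf3_lt_d010_certfloor (hE : klCertB1gD010.EnclosuresB1g) :
    ∀ bx ∈ klCertB1gD010.boxes,
      klU0_d010_certfloor_nc16384_2loop_C4_0.ThirdOrderEnclosures ((bx.mulo : ℚ) : ℝ)
          (bx.bB1g.trialFun klCertB1gD010.trials) →
        (klU0w43.row.chanOf D4Irrep.A2g).ThirdOrderLowerBound ((bx.mulo : ℚ) : ℝ) D4Irrep.B1g →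
          ∀ U : ℝ, 0 < U → U ≤ 1215 / 1048576 → ∀ χ : D4Irrep, χ ≠ D4Irrep.B1g →
            channelInf3 (squareDispersion 1 0) ((bx.mulo : ℚ) : ℝ) U D4Irrep.B1g <
              channelInf3 (squareDispersion 1 0) ((bx.mulo : ℚ) : ℝ) U χ := by
  intro bx hbx h3 hB1g U hU hUU χ hχ
  have hall := List.all_eq_true.1 klCertB1gD010_boxes_all bx hbx
  simp only [Bool.and_eq_true] at hall
  have hB := hall.1
  have hB' := hB
  simp only [KLBox.basicOKB1g, Bool.and_eq_true, decide_eq_true_eq] at hB'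
  obtain ⟨⟨⟨⟨⟨⟨⟨h4, hle⟩, h0⟩, -⟩, -⟩, -⟩, -⟩, -⟩ := hB'
  have hμI : ((bx.mulo : ℚ) : ℝ) ∈ Set.Icc ((bx.mulo : ℚ) : ℝ) ((bx.muhi : ℚ) : ℝ) :=
    ⟨le_rfl, by exact_mod_cast hle⟩
  have hμ : ((bx.mulo : ℚ) : ℝ) ∈ Set.Ioo (-4 : ℝ) 0 :=
    ⟨by exact_mod_cast h4, lt_of_le_of_lt (by exact_mod_cast hle : ((bx.mulo : ℚ) : ℝ) ≤ bx.muhi) (by exact_mod_cast h0)⟩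
  obtain ⟨hER, hEχ⟩ := hE bx hbx _ hμI
  obtain ⟨hritz, hlower⟩ := klto_lower_of_basicOKB1g hμ bx klCertB1gD010.trials hB hEχ
  refine klThirdOrder_channelInf3_lt hμ bx klCertB1gD010.trials hritz hER hlower _
    klU0_d010_certfloor_nc16384_2loop_C4_0_ok (List.all_eq_true.1 klto_d010_certfloor_dominates bx hbx) h3 _ hB1g U hU ?_ χ hχ
  have hU0 : klU0_d010_certfloor_nc16384_2loop_C4_0.U0 = (1215 : ℚ) / 1048576 := rfl
  rw [hU0]
  push_cast
  exact hUU

end Summit.HubbardSuperconductivity.HubbardSuperconductivity.Theorems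

end
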